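import Mathlib
import HarnessLib
import Literature.NumberTheory.LFunctions.SiegelIdealCoefficients
import Summits.NavierStokesRegularity.NavierStokesRegularity.Theorems.TaylorModelRungThreeSoundnessMajorant

/-!
# Line `taylor-model` on crux K1b-DR (`ExactWindowRungThree.DerivativeEnclosureCertificateR`,
# stmt-NavierStokesRegularity-23954) — stub S1 `stub_soundness`, helper 2: the majorant series

Toward the registered stub `stub_soundness : TaylorModelSoundness` (skeleton v3 `9391589be9c875b2`,
line owner ns-idea-2 g3; Parts A3/B2/B3 of `S1-PROOFPLAN.md`). From the coefficient majorants of
`TaylorModelRungThreeSoundnessMajorant.lean` to bounds on the vector power series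
`pseries (T x) s = Σ_k T x k s^k` (the flow) and `pseries (U x z) s` (its first variation) for `0 ≤ s`,
`b m s < 1`:

* scalar sums `Σ q^k = 1/(1-q)`, `Σ (k+1) q^k = 1/(1-q)²` and their tails
  (`hasSum_geom`, the tree's `Literature.NumberTheory.LFunctions.SiegelIdealCoefficients.hasSum_succ_mul_geometric`, `…_tail`);
* generic transfer `|a k|_c ≤ A k · w_c` ⇒ summability, `|Σ a k s^k|_c ≤ (Σ A k s^k) · w_c` and the tail
  version (`summable_of_coeff_bound`, `abs_pseries_le`, `abs_pseries_sub_sum_le`);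
* the S1 shapes: enclosure `|Σ T x k s^k|_c ≤ m/(1-bms)·w_c`, Taylor remainder
  `m (bms)^(p+1)/(1-bms)`, variational bound `ζ/(1-bms)²` and tail, first-variation bound
  `(m+ρ)/(1-b(m+ρ)s) - m/(1-bms)`, second-order remainder `… - ρ/(1-bms)²`, and the variation of the
  variation `ζ (1/(1-b(m+ρ)s)² - 1/(1-bms)²)`.

MODEL-lattice bookkeeping only (rung TL-M3 of the NS ladder); nothing here is a statement about the
Navier–Stokes equations.
-/

noncomputable section

-- the sub-problem namespace repeats the summit name by design (D-0017)
set_option linter.dupNamespace false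

namespace Summit.NavierStokesRegularity.NavierStokesRegularity.Theorems.TaylorModelMajorant

open scoped BigOperators Topology
open Finset Set Filter

/-! ### Scalar majorant series: `Σ q^k`, `Σ (k+1) q^k` and their tails -/

section Scalar

/-- Transport a `HasSum` along pointwise equality of the terms and equality of the sums. [folklore] -/
theorem hasSum_of_eq {f g : ℕ → ℝ} {a a' : ℝ} (hf : HasSum f a) (h1 : ∀ k, g k = f k)
    (h2 : a' = a) : HasSum g a' :=
  h2 ▸ hf.congr_fun h1

/-- `Σ_k q^k = 1/(1-q)` for `0 ≤ q < 1`. [folklore] -/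
theorem hasSum_geom {q : ℝ} (h0 : 0 ≤ q) (h1 : q < 1) : HasSum (fun k : ℕ => q ^ k) (1 - q)⁻¹ :=
  hasSum_geometric_of_lt_one h0 h1

/-- Tail of the geometric series: `Σ_k q^(k+p+1) = q^(p+1)/(1-q)`. [folklore] -/
theorem hasSum_geom_tail {q : ℝ} (h0 : 0 ≤ q) (h1 : q < 1) (p : ℕ) :
    HasSum (fun k : ℕ => q ^ (k + (p + 1))) (q ^ (p + 1) * (1 - q)⁻¹) := by
  exact hasSum_of_eq ((hasSum_geom h0 h1).mul_left (q ^ (p + 1))) (fun k => by rw [pow_add, mul_comm])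
    rfl

/-- Tail of `Σ (k+1) q^k`: `Σ_{k ≥ p+1} (k+1) q^k = ((p+2) q^(p+1) - (p+1) q^(p+2))/(1-q)²`. [folklore] -/
theorem hasSum_succ_mul_geom_tail {q : ℝ} (h0 : 0 ≤ q) (h1 : q < 1) (p : ℕ) :
    HasSum (fun k : ℕ => (((k + (p + 1) : ℕ) : ℝ) + 1) * q ^ (k + (p + 1)))
      ((((p : ℝ) + 2) * q ^ (p + 1) - ((p : ℝ) + 1) * q ^ (p + 2)) / (1 - q) ^ 2) := by
  have h1' : (1 : ℝ) - q ≠ 0 := (sub_pos.2 h1).ne'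
  have A := ((Literature.NumberTheory.LFunctions.SiegelIdealCoefficients.hasSum_succ_mul_geometric h0 h1).add ((hasSum_geom h0 h1).mul_left ((p : ℝ) + 1))).mul_left
    (q ^ (p + 1))
  refine hasSum_of_eq A (fun k => by push_cast; ring) ?_
  field_simp
  ring

end Scalar

/-! ### From coefficient majorants to series bounds (componentwise) -/

section Generic

variable {n : ℕ} {w : Fin n → ℝ} {a : ℕ → Fin n → ℝ} {A : ℕ → ℝ} {s S : ℝ} {c : Fin n}

/-- A coefficient majorant `|a k|_c ≤ A k · w_c` with `Σ A k s^k` convergent (`s ≥ 0`) makes the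
component series summable. [folklore] -/
theorem summable_of_coeff_bound (hs : 0 ≤ s) (ha : ∀ k, |a k c| ≤ A k * w c)
    (hA : HasSum (fun k => A k * s ^ k) S) : Summable (fun k => a k c * s ^ k) := by
  refine Summable.of_norm_bounded (g := fun k => A k * s ^ k * w c) ((hA.mul_right (w c)).summable)
    fun k => ?_
  rw [Real.norm_eq_abs, abs_mul, abs_of_nonneg (pow_nonneg hs k)]
  calc |a k c| * s ^ k ≤ A k * w c * s ^ k := mul_le_mul_of_nonneg_right (ha k) (pow_nonneg hs k)
    _ = A k * s ^ k * w c := by ring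

/-- … and bounds its sum: `|Σ a k s^k|_c ≤ (Σ A k s^k) · w_c`. [folklore] -/
theorem abs_pseries_le (hs : 0 ≤ s) (ha : ∀ k, |a k c| ≤ A k * w c)
    (hA : HasSum (fun k => A k * s ^ k) S) : |pseries a s c| ≤ S * w c := by
  have key := tsum_of_norm_bounded (hA.mul_right (w c)) (f := fun k => a k c * s ^ k) fun k => by
    rw [Real.norm_eq_abs, abs_mul, abs_of_nonneg (pow_nonneg hs k)]
    calc |a k c| * s ^ k ≤ A k * w c * s ^ k := mul_le_mul_of_nonneg_right (ha k) (pow_nonneg hs k)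
      _ = A k * s ^ k * w c := by ring
  simpa only [pseries, Real.norm_eq_abs] using key

/-- … and its tails: `|Σ a k s^k - Σ_{k≤p} a k s^k|_c ≤ (Σ_{k>p} A k s^k) · w_c`. [folklore] -/
theorem abs_pseries_sub_sum_le (hs : 0 ≤ s) (p : ℕ) (ha : ∀ k, |a k c| ≤ A k * w c)
    (hA : HasSum (fun k => A k * s ^ k) S) {S' : ℝ}
    (hT : HasSum (fun k => A (k + (p + 1)) * s ^ (k + (p + 1))) S') :
    |pseries a s c - ∑ k ∈ Finset.range (p + 1), a k c * s ^ k| ≤ S' * w c := by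
  have hsum : Summable (fun k => a k c * s ^ k) := summable_of_coeff_bound hs ha hA
  have split : pseries a s c - ∑ k ∈ Finset.range (p + 1), a k c * s ^ k =
      ∑' k, a (k + (p + 1)) c * s ^ (k + (p + 1)) := by
    simp only [pseries]
    rw [← hsum.sum_add_tsum_nat_add (p + 1), add_sub_cancel_left]
  rw [split]
  have key := tsum_of_norm_bounded (hT.mul_right (w c))
    (f := fun k => a (k + (p + 1)) c * s ^ (k + (p + 1))) fun k => by
    rw [Real.norm_eq_abs, abs_mul, abs_of_nonneg (pow_nonneg hs _)]
    calc |a (k + (p + 1)) c| * s ^ (k + (p + 1))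
        ≤ A (k + (p + 1)) * w c * s ^ (k + (p + 1)) :=
          mul_le_mul_of_nonneg_right (ha _) (pow_nonneg hs _)
      _ = A (k + (p + 1)) * s ^ (k + (p + 1)) * w c := by ring
  simpa only [Real.norm_eq_abs] using key

/-- Componentwise difference of two summable vector series. [folklore] -/
theorem pseries_sub {a a' : ℕ → Fin n → ℝ} (ha : Summable (fun k => a k c * s ^ k))
    (ha' : Summable (fun k => a' k c * s ^ k)) :
    pseries a s c - pseries a' s c = pseries (fun k => a k - a' k) s c := by
  simp only [pseries, Pi.sub_apply, sub_mul]
  rw [ha.tsum_sub ha']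

end Generic

variable {n : ℕ} {Q : (Fin n → ℝ) → (Fin n → ℝ) → Fin n → ℝ} {w : Fin n → ℝ} {b : ℝ}
  {T : (Fin n → ℝ) → ℕ → Fin n → ℝ} {U : (Fin n → ℝ) → (Fin n → ℝ) → ℕ → Fin n → ℝ}

namespace IsMajorantSystem

variable (h : IsMajorantSystem n Q w b T U)
include h

/-! ### The majorant sums of the system -/

/-- `Σ m (bm)^k s^k = m/(1 - b m s)`. [folklore] -/
theorem hasSum_T_majorant {m s : ℝ} (hm : 0 ≤ m) (hs : 0 ≤ s) (hq : b * m * s < 1) :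
    HasSum (fun k : ℕ => m * (b * m) ^ k * s ^ k) (m / (1 - b * m * s)) := by
  have hq0 : 0 ≤ b * m * s := mul_nonneg (mul_nonneg h.b_nonneg hm) hs
  exact hasSum_of_eq ((hasSum_geom hq0 hq).mul_left m) (fun k => by rw [mul_pow, mul_pow]; ring)
    (div_eq_mul_inv _ _)

/-- `Σ_{k>p} m (bm)^k s^k = m (bms)^(p+1)/(1 - b m s)`. [folklore] -/
theorem hasSum_T_majorant_tail {m s : ℝ} (hm : 0 ≤ m) (hs : 0 ≤ s) (hq : b * m * s < 1) (p : ℕ) :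
    HasSum (fun k : ℕ => m * (b * m) ^ (k + (p + 1)) * s ^ (k + (p + 1)))
      (m * (b * m * s) ^ (p + 1) / (1 - b * m * s)) := by
  have hq0 : 0 ≤ b * m * s := mul_nonneg (mul_nonneg h.b_nonneg hm) hs
  exact hasSum_of_eq ((hasSum_geom_tail hq0 hq p).mul_left m) (fun k => by rw [mul_pow, mul_pow]; ring)
    (by rw [div_eq_mul_inv, mul_assoc])

/-- `Σ (k+1) ρ (bm)^k s^k = ρ/(1 - b m s)²`. [folklore] -/
theorem hasSum_U_majorant {m s : ℝ} (ρ : ℝ) (hm : 0 ≤ m) (hs : 0 ≤ s) (hq : b * m * s < 1) :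
    HasSum (fun k : ℕ => ((k : ℝ) + 1) * ρ * (b * m) ^ k * s ^ k) (ρ / (1 - b * m * s) ^ 2) := by
  have hq0 : 0 ≤ b * m * s := mul_nonneg (mul_nonneg h.b_nonneg hm) hs
  exact hasSum_of_eq ((Literature.NumberTheory.LFunctions.SiegelIdealCoefficients.hasSum_succ_mul_geometric hq0 hq).mul_left ρ) (fun k => by rw [mul_pow]; ring)
    (div_eq_mul_inv _ _)

/-- `Σ_{k>p} (k+1) ρ (bm)^k s^k = ρ ((p+2) q^(p+1) - (p+1) q^(p+2))/(1-q)²`, `q = b m s`. [folklore] -/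
theorem hasSum_U_majorant_tail {m s : ℝ} (ρ : ℝ) (hm : 0 ≤ m) (hs : 0 ≤ s) (hq : b * m * s < 1)
    (p : ℕ) :
    HasSum (fun k : ℕ => (((k + (p + 1) : ℕ) : ℝ) + 1) * ρ * (b * m) ^ (k + (p + 1)) * s ^ (k + (p + 1)))
      (ρ * ((((p : ℝ) + 2) * (b * m * s) ^ (p + 1) - ((p : ℝ) + 1) * (b * m * s) ^ (p + 2)) /
        (1 - b * m * s) ^ 2)) := by
  have hq0 : 0 ≤ b * m * s := mul_nonneg (mul_nonneg h.b_nonneg hm) hs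
  exact hasSum_of_eq ((hasSum_succ_mul_geom_tail hq0 hq p).mul_left ρ) (fun k => by rw [mul_pow]; ring)
    rfl

/-! ### The Taylor series of the flow: summability, enclosure, remainder -/

/-- For `|x| ≤ m·w`, `0 ≤ s`, `b m s < 1` the component Taylor series `Σ_k T x k c s^k` converges.
[folklore] -/
theorem summable_T {x : Fin n → ℝ} {m s : ℝ} (hx : ∀ c, |x c| ≤ m * w c) (hs : 0 ≤ s)
    (hq : b * m * s < 1) (c : Fin n) : Summable (fun k => T x k c * s ^ k) :=
  summable_of_coeff_bound hs (fun k => h.T_bound hx k c)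
    (h.hasSum_T_majorant (h.nonneg_of_wbound c (hx c)) hs hq)

/-- **Enclosure**: `|Σ_k T x k s^k|_c ≤ m/(1 - b m s) · w_c`. [folklore] -/
theorem abs_pseries_T_le {x : Fin n → ℝ} {m s : ℝ} (hx : ∀ c, |x c| ≤ m * w c) (hs : 0 ≤ s)
    (hq : b * m * s < 1) (c : Fin n) : |pseries (T x) s c| ≤ m / (1 - b * m * s) * w c :=
  abs_pseries_le hs (fun k => h.T_bound hx k c) (h.hasSum_T_majorant (h.nonneg_of_wbound c (hx c)) hs hq)

/-- **Taylor remainder**: `|Σ_k T x k s^k - Σ_{k≤p} T x k s^k|_c ≤ m (bms)^(p+1)/(1 - bms) · w_c` (tail of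
the SAME majorant series, sharper than Lagrange). [folklore] -/
theorem abs_pseries_T_sub_sum_le {x : Fin n → ℝ} {m s : ℝ} (hx : ∀ c, |x c| ≤ m * w c) (hs : 0 ≤ s)
    (hq : b * m * s < 1) (p : ℕ) (c : Fin n) :
    |pseries (T x) s c - ∑ k ∈ Finset.range (p + 1), T x k c * s ^ k| ≤
      m * (b * m * s) ^ (p + 1) / (1 - b * m * s) * w c :=
  abs_pseries_sub_sum_le hs p (fun k => h.T_bound hx k c)
    (h.hasSum_T_majorant (h.nonneg_of_wbound c (hx c)) hs hq)
    (h.hasSum_T_majorant_tail (h.nonneg_of_wbound c (hx c)) hs hq p)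

/-! ### The variational series -/

/-- For `|x| ≤ m·w`, any direction `z` with `|z| ≤ ζ·w`, `0 ≤ s`, `b m s < 1`: the component
variational series `Σ_k U x z k c s^k` converges. [folklore] -/
theorem summable_U {x z : Fin n → ℝ} {m ζ s : ℝ} (hx : ∀ c, |x c| ≤ m * w c)
    (hz : ∀ c, |z c| ≤ ζ * w c) (hs : 0 ≤ s) (hq : b * m * s < 1) (c : Fin n) :
    Summable (fun k => U x z k c * s ^ k) :=
  summable_of_coeff_bound hs (fun k => h.U_bound hx hz k c)
    (h.hasSum_U_majorant ζ (h.nonneg_of_wbound c (hx c)) hs hq)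

/-- `|Σ_k U x z k s^k|_c ≤ ζ/(1 - b m s)² · w_c`. [folklore] -/
theorem abs_pseries_U_le {x z : Fin n → ℝ} {m ζ s : ℝ} (hx : ∀ c, |x c| ≤ m * w c)
    (hz : ∀ c, |z c| ≤ ζ * w c) (hs : 0 ≤ s) (hq : b * m * s < 1) (c : Fin n) :
    |pseries (U x z) s c| ≤ ζ / (1 - b * m * s) ^ 2 * w c :=
  abs_pseries_le hs (fun k => h.U_bound hx hz k c)
    (h.hasSum_U_majorant ζ (h.nonneg_of_wbound c (hx c)) hs hq)

/-- Tail of the variational series: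
`|Σ_k U x z k s^k - Σ_{k≤p} U x z k s^k|_c ≤ ζ ((p+2) q^(p+1) - (p+1) q^(p+2))/(1-q)² · w_c`. [folklore] -/
theorem abs_pseries_U_sub_sum_le {x z : Fin n → ℝ} {m ζ s : ℝ} (hx : ∀ c, |x c| ≤ m * w c)
    (hz : ∀ c, |z c| ≤ ζ * w c) (hs : 0 ≤ s) (hq : b * m * s < 1) (p : ℕ) (c : Fin n) :
    |pseries (U x z) s c - ∑ k ∈ Finset.range (p + 1), U x z k c * s ^ k| ≤
      ζ * ((((p : ℝ) + 2) * (b * m * s) ^ (p + 1) - ((p : ℝ) + 1) * (b * m * s) ^ (p + 2)) /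
        (1 - b * m * s) ^ 2) * w c :=
  abs_pseries_sub_sum_le hs p (fun k => h.U_bound hx hz k c)
    (h.hasSum_U_majorant ζ (h.nonneg_of_wbound c (hx c)) hs hq)
    (h.hasSum_U_majorant_tail ζ (h.nonneg_of_wbound c (hx c)) hs hq p)

/-! ### Differences: first variation, second-order remainder, variation of the variation -/

/-- `b m s < 1` follows from `b (m+ρ) s < 1` when `ρ, s ≥ 0`. [folklore] -/
theorem lt_one_of_add {m ρ s : ℝ} (hρ : 0 ≤ ρ) (hs : 0 ≤ s) (hq : b * (m + ρ) * s < 1) :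
    b * m * s < 1 := by
  have : b * m * s ≤ b * (m + ρ) * s := by
    have hb := h.b_nonneg
    nlinarith [mul_nonneg (mul_nonneg hb hρ) hs]
  exact this.trans_lt hq

/-- **First variation (Lipschitz) enclosure**:
`|Σ T (x+v) k s^k - Σ T x k s^k|_c ≤ ((m+ρ)/(1-b(m+ρ)s) - m/(1-bms)) · w_c`. [folklore] -/
theorem abs_pseries_T_sub_le {x v : Fin n → ℝ} {m ρ s : ℝ} (hx : ∀ c, |x c| ≤ m * w c)
    (hv : ∀ c, |v c| ≤ ρ * w c) (hs : 0 ≤ s) (hq : b * (m + ρ) * s < 1) (c : Fin n) :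
    |pseries (T (x + v)) s c - pseries (T x) s c| ≤
      ((m + ρ) / (1 - b * (m + ρ) * s) - m / (1 - b * m * s)) * w c := by
  have hm := h.nonneg_of_wbound c (hx c)
  have hρ := h.nonneg_of_wbound c (hv c)
  have hq1 := h.lt_one_of_add hρ hs hq
  have H := (h.hasSum_T_majorant (add_nonneg hm hρ) hs hq).sub (h.hasSum_T_majorant hm hs hq1)
  rw [pseries_sub (h.summable_T (wbound_add hx hv) hs hq c) (h.summable_T hx hs hq1 c)]
  refine abs_pseries_le hs (fun k => ?_) (A := fun k => (m + ρ) * (b * (m + ρ)) ^ k - m * (b * m) ^ k) ?_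
  · exact h.T_sub_bound hx hv k c
  · exact hasSum_of_eq H (fun k => by ring) rfl

/-- **Second-order remainder of the flow in the initial condition** (full series):
`|Σ T (x+v) k s^k - Σ T x k s^k - Σ U x v k s^k|_c ≤ ((m+ρ)/(1-b(m+ρ)s) - m/(1-bms) - ρ/(1-bms)²) · w_c`.
[folklore] -/
theorem abs_pseries_taylor2_le {x v : Fin n → ℝ} {m ρ s : ℝ} (hx : ∀ c, |x c| ≤ m * w c)
    (hv : ∀ c, |v c| ≤ ρ * w c) (hs : 0 ≤ s) (hq : b * (m + ρ) * s < 1) (c : Fin n) :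
    |pseries (T (x + v)) s c - pseries (T x) s c - pseries (U x v) s c| ≤
      ((m + ρ) / (1 - b * (m + ρ) * s) - m / (1 - b * m * s) - ρ / (1 - b * m * s) ^ 2) * w c := by
  have hm := h.nonneg_of_wbound c (hx c)
  have hρ := h.nonneg_of_wbound c (hv c)
  have hq1 := h.lt_one_of_add hρ hs hq
  have H := ((h.hasSum_T_majorant (add_nonneg hm hρ) hs hq).sub (h.hasSum_T_majorant hm hs hq1)).sub
    (h.hasSum_U_majorant ρ hm hs hq1)
  have h1 := h.summable_T (wbound_add hx hv) hs hq c
  have h2 := h.summable_T hx hs hq1 c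
  have h3 := h.summable_U hx hv hs hq1 c
  have h12 : Summable (fun k => (fun k => T (x + v) k - T x k) k c * s ^ k) := by
    simpa only [Pi.sub_apply, sub_mul] using h1.sub h2
  rw [pseries_sub h1 h2, pseries_sub h12 h3]
  refine abs_pseries_le hs (fun k => ?_)
    (A := fun k => (m + ρ) * (b * (m + ρ)) ^ k - m * (b * m) ^ k - ((k : ℝ) + 1) * ρ * (b * m) ^ k) ?_
  · simpa only [Pi.sub_apply] using h.T_taylor2_bound hx hv k c
  · exact hasSum_of_eq H (fun k => by ring) rfl

/-- **Variation of the variation**: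
`|Σ U (x+v) z k s^k - Σ U x z k s^k|_c ≤ ζ (1/(1-b(m+ρ)s)² - 1/(1-bms)²) · w_c`. [folklore] -/
theorem abs_pseries_U_sub_le {x v z : Fin n → ℝ} {m ρ ζ s : ℝ} (hx : ∀ c, |x c| ≤ m * w c)
    (hv : ∀ c, |v c| ≤ ρ * w c) (hz : ∀ c, |z c| ≤ ζ * w c) (hs : 0 ≤ s)
    (hq : b * (m + ρ) * s < 1) (c : Fin n) :
    |pseries (U (x + v) z) s c - pseries (U x z) s c| ≤
      ζ * (1 / (1 - b * (m + ρ) * s) ^ 2 - 1 / (1 - b * m * s) ^ 2) * w c := by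
  have hm := h.nonneg_of_wbound c (hx c)
  have hρ := h.nonneg_of_wbound c (hv c)
  have hq1 := h.lt_one_of_add hρ hs hq
  have H := (h.hasSum_U_majorant ζ (add_nonneg hm hρ) hs hq).sub (h.hasSum_U_majorant ζ hm hs hq1)
  rw [pseries_sub (h.summable_U (wbound_add hx hv) hz hs hq c) (h.summable_U hx hz hs hq1 c)]
  refine abs_pseries_le hs (fun k => ?_)
    (A := fun k => ((k : ℝ) + 1) * ζ * ((b * (m + ρ)) ^ k - (b * m) ^ k)) ?_
  · exact h.U_sub_bound hx hv hz k c
  · exact hasSum_of_eq H (fun k => by ring) (by rw [one_div, one_div, div_eq_mul_inv, div_eq_mul_inv]; ring)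

end IsMajorantSystem

end Summit.NavierStokesRegularity.NavierStokesRegularity.Theorems.TaylorModelMajorant

end
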